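import Mathlib
import HarnessLib
import Summits.ResolutionOfSingularities.ResolutionOfSingularities.Theorems.WildQuotientsWildQuotientResolutionS1aKillCertCoverEq
import Summits.ResolutionOfSingularities.ResolutionOfSingularities.Theorems.WildQuotientsWildQuotientResolutionS1aKillLeafFamily
import Summits.ResolutionOfSingularities.ResolutionOfSingularities.Theorems.WildQuotientsWildQuotientResolutionS1aTraceSections
import Summits.ResolutionOfSingularities.ResolutionOfSingularities.Theorems.WildQuotientsWildQuotientResolutionS1aZeroLocusUnit
import Summits.ResolutionOfSingularities.ResolutionOfSingularities.Theorems.WildQuotientsWildQuotientResolutionS1aVeroneseAtoms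

/-!
# S1a — ONE-MOVE KILL BY A GLUED PRINCIPAL CENTRE PRESENTED BY SECTIONS ON SEVERAL CHARTS (`killsIn_one_of_sectionCharts`)

[OURS · L1 W4.5c · lead-1 g17; plan-1 RULINGS R-F15q/r/s ★ R4e-rational `graphTail_killsIn_two`, SPEC §2: the level-2 centre of R4e is ONE connected surface `S′`
read on the `r` producer charts `O′ᵢ₁`; this file is the SCHEME-LEVEL gluing-and-kill step, free of chart-ring types] — NOT statements of the manuscript; counted 0;
AI-level work, weaker than expert review. Crux stmt-ResolutionOfSingularities-17941 `CyclicQuotientFourfolds`, line `s1a-logminvertex` v13 (`stub_reachLowerInFX`).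

DATA: finitely many `G`-stable affine charts `O i` of a model `M`, each with a principal-centre-chart filtration `𝒦₀ i` (common Veronese degree `d`) which ON EVERY
AFFINE `U ≤ O i` is the weighted filtration of the restrictions of SECTIONS `a i l ∈ Γ(M, O i)` (weights `w l > 0`); global sections `glob l` and chart sections
`R i l` with `a i l · R i l = glob l|O i` and `R i l` invertible on `O i ∩ O j` for `j ≠ i` (so neighbouring generators are ASSOCIATED on overlaps); an open family
`Uc` covering `M` together with the `O i`, on each member of which, chart by chart, one of the `a i l` is invertible (so the closure of `V(a i) ∩ O i` stays inside
`⋃ O j`); an atlas whose carried formal locus lies in `⋃ O i`.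
* `isUnit_map_of_le_basicOpen`, `associated_of_mul_unit_eq` — restriction to an open inside `D(s)` is a unit; `x u = y u′` with units ⇒ `x ~ y`;
* ★★ `GameFrame.GModel.killsIn_one_of_sectionCharts` — then `KillsIn 1 M`: glue (✓`exists_isPrincipalCentre_of_agree_filtration_eq`) and kill
  (✓`killsIn_one_of_disjointPrincipalFamily_datum`, one centre, charts `O i`).
-/

set_option linter.dupNamespace false

noncomputable section

open CategoryTheory Limits AlgebraicGeometry TopologicalSpace Topology Opposite
open Literature.AlgebraicGeometry.Resolution Literature.AlgebraicGeometry.RelativeSpec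
open Summit.ResolutionOfSingularities.ResolutionOfSingularities.Theorems.WildQuotientResolution.S1
open Summit.ResolutionOfSingularities.ResolutionOfSingularities.Theorems.WildQuotientResolution.S1.NodeAtlas
open Summit.ResolutionOfSingularities.ResolutionOfSingularities.Theorems.WildQuotientResolution.S1.NpFrame
open Summit.ResolutionOfSingularities.ResolutionOfSingularities.Theorems.WildQuotientResolution.S1.KillGlue

namespace AlgebraicGeometry.Scheme

/-- **The restriction of a section to an open inside its basic open is a unit.** [folklore] -/
theorem isUnit_map_of_le_basicOpen {V : Scheme} {W U : V.Opens} (s : Γ(V, W)) (hU : U ≤ W) (hb : U ≤ V.basicOpen s) :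
    IsUnit ((V.presheaf.map (homOfLE hU).op).hom s) := by
  refine RingedSpace.isUnit_of_isUnit_germ (X := V.toRingedSpace) U _ fun x hx => ?_
  change IsUnit ((V.presheaf.germ U x hx).hom ((V.presheaf.map (homOfLE hU).op).hom s))
  rw [← CommRingCat.comp_apply, V.presheaf.germ_res (homOfLE hU) x hx]
  exact (V.mem_basicOpen s x (hU hx)).mp (hb hx)

end AlgebraicGeometry.Scheme

/-- `x·u = y·u′` with `u, u′` units ⇒ `x` and `y` are associated. [folklore] -/
theorem associated_of_mul_unit_eq {A : Type*} [CommMonoid A] {x y u u' : A} (hu : IsUnit u) (hu' : IsUnit u') (h : x * u = y * u') : Associated x y := by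
  obtain ⟨a, rfl⟩ := hu
  obtain ⟨b, rfl⟩ := hu'
  refine ⟨a * b⁻¹, ?_⟩
  rw [Units.val_mul, ← mul_assoc, h, mul_assoc, Units.mul_inv, mul_one]

namespace Summit.ResolutionOfSingularities.ResolutionOfSingularities.Theorems.WildQuotientResolution.S1.GameFrame.GModel

variable {p : ℕ} {X' X₁ : Scheme.{0}} {q : X' ⟶ X₁} {G : Type} [Group G] {ρ : G →* Aut X'} {g₀ : G}

set_option maxHeartbeats 800000 in
/-- ★★ **ONE-MOVE KILL BY A GLUED PRINCIPAL CENTRE PRESENTED BY SECTIONS ON SEVERAL CHARTS.** See the module docstring. [OURS · L1 W4.5c · R4e SPEC §2; NOT a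
statement of the manuscript] -/
theorem killsIn_one_of_sectionCharts [Finite G] (hp : p.Prime) (hG : ∀ g : G, g ∈ Subgroup.zpowers g₀)
    {k : Type} [Field k] (f : X₁ ⟶ Spec (.of k)) [LocallyOfFiniteType f] [IsFinite q]
    (M : GModel p q G ρ g₀) [M.V.IsSeparated] (𝔄 : NodeAtlasData p M.act g₀)
    {η : Type} [Finite η] (O : η → M.act.StableAffineOpens) (𝒦₀ : η → ReesFiltration M.V) {d : ℕ} (hd : 0 < d)
    (hprin : ∀ i, IsPrincipalCentreChart p M.act g₀ (𝒦₀ i) d (O i))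
    {c : ℕ} (w : Fin c → ℕ) (hw : ∀ l, 0 < w l) (a : ∀ i, Fin c → Γ(M.V, (O i).1))
    (hsec : ∀ i (U : M.V.affineOpens) (hU : U.1 ≤ (O i).1) (n : ℕ),
      ((𝒦₀ i).filtration U).ideal n = (weightedFiltration (fun l => (M.V.presheaf.map (homOfLE hU).op).hom (a i l)) w).ideal n)
    (glob : Fin c → Γ(M.V, ⊤)) (R : ∀ i, Fin c → Γ(M.V, (O i).1))
    (hR : ∀ i l, a i l * R i l = (M.V.presheaf.map (homOfLE le_top).op).hom (glob l))
    (hRunit : ∀ i j, i ≠ j → ∀ l, ∀ v ∈ (O i).1, v ∈ (O j).1 → v ∈ M.V.basicOpen (R i l))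
    {A : Type} (Uc : A → M.V.Opens) (hcov : ∀ x : M.V, (x ∈ ⋃ i, ((O i).1 : Set M.V)) ∨ ∃ a', x ∈ Uc a')
    (hunit : ∀ a' i, ∃ l, ∀ v ∈ (O i).1, v ∈ Uc a' → v ∈ M.V.basicOpen (a i l))
    (hF : 𝔄.fLocus ⊆ ⋃ i, ((O i).1 : Set M.V)) : KillsIn 1 M := by
  classical
  haveI : Fintype η := Fintype.ofFinite η
  have hO : ∀ i, IsAffineOpen (O i).1 := fun i => (hprin i).1
  -- agreement on overlaps: associated generators
  have hagree : ∀ i j (U : M.V.affineOpens), U.1 ≤ (O i).1 → U.1 ≤ (O j).1 → ∀ n, ((𝒦₀ i).filtration U).ideal n = ((𝒦₀ j).filtration U).ideal n := by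
    intro i j U hi hj n
    rw [hsec i U hi n, hsec j U hj n]
    refine CoarseChart.weightedFiltration_eq_of_associated _ _ w (fun l => ?_) n
    by_cases hij : i = j
    · subst hij; exact Associated.refl _
    · have hgi := congrArg (M.V.presheaf.map (homOfLE hi).op).hom (hR i l)
      have hgj := congrArg (M.V.presheaf.map (homOfLE hj).op).hom (hR j l)
      rw [map_mul, ← CommRingCat.comp_apply, ← Functor.map_comp] at hgi hgj
      have heq : (M.V.presheaf.map (homOfLE hi).op).hom (a i l) * (M.V.presheaf.map (homOfLE hi).op).hom (R i l) =
          (M.V.presheaf.map (homOfLE hj).op).hom (a j l) * (M.V.presheaf.map (homOfLE hj).op).hom (R j l) := by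
        rw [hgi, hgj]; rfl
      exact associated_of_mul_unit_eq
        (Scheme.isUnit_map_of_le_basicOpen (R i l) hi fun v hv => hRunit i j hij l v (hi hv) (hj hv))
        (Scheme.isUnit_map_of_le_basicOpen (R j l) hj fun v hv => hRunit j i (Ne.symm hij) l v (hj hv) (hi hv)) heq
  -- the closed set `B`
  let B : Set M.V := ⋃ i, closure (M.V.zeroLocus (U := (O i).1) (Set.range (a i)) ∩ ((O i).1 : Set M.V))
  have hBc : IsClosed B := isClosed_iUnion_of_finite fun i => isClosed_closure
  have hBcov : B ⊆ ⋃ i, ((O i).1 : Set M.V) := by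
    refine Set.iUnion_subset fun i => ?_
    choose l hl using fun a' => hunit a' i
    exact Scheme.closure_zeroLocus_inter_subset_of_cover_of_subset (O i).1 (⋃ j, ((O j).1 : Set M.V)) Uc hcov (Set.range (a i)) (fun a' => a i (l a'))
      (fun a' => ⟨1, one_pos, by rw [pow_one]; exact ⟨l a', rfl⟩⟩) (fun a' v hv hva => hl a' v hv hva)
  have hsupp : ∀ i, (((𝒦₀ i).ideal d).support : Set M.V) ∩ (O i).1 ⊆ B := by
    intro i v ⟨hvs, hvO⟩
    refine Set.mem_iUnion.mpr ⟨i, subset_closure ⟨?_, hvO⟩⟩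
    have hz := (Scheme.IdealSheafData.mem_support_iff_of_mem (I := (𝒦₀ i).ideal d) (U := ⟨(O i).1, hO i⟩) hvO).mp hvs
    rw [Scheme.mem_zeroLocus_iff] at hz ⊢
    rintro _ ⟨l, rfl⟩ hv
    have hmem : a i l ^ d ∈ ((𝒦₀ i).ideal d).ideal ⟨(O i).1, hO i⟩ := by
      rw [← ReesFiltration.filtration_ideal, hsec i ⟨(O i).1, hO i⟩ le_rfl d]
      have hal : (M.V.presheaf.map (homOfLE (le_refl (O i).1)).op).hom (a i l) = a i l := by
        have : (homOfLE (le_refl (O i).1)).op = 𝟙 _ := rfl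
        rw [this, M.V.presheaf.map_id]; rfl
      have h1 : a i l ∈ (weightedFiltration (fun l => (M.V.presheaf.map (homOfLE (le_refl (O i).1)).op).hom (a i l)) w).ideal (w l) := by
        have := mem_weightedFiltration_ideal (fun l => (M.V.presheaf.map (homOfLE (le_refl (O i).1)).op).hom (a i l)) w l
        rwa [hal] at this
      have h2 : a i l ^ d ∈ (weightedFiltration (fun l => (M.V.presheaf.map (homOfLE (le_refl (O i).1)).op).hom (a i l)) w).ideal (w l * d) :=
        Veronese.idealFiltration_pow_le _ (w l) d (Ideal.pow_mem_pow h1 d)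
      exact (weightedFiltration (fun l => (M.V.presheaf.map (homOfLE (le_refl (O i).1)).op).hom (a i l)) w).antitone (Nat.le_mul_of_pos_left d (hw l)) h2
    exact hz _ hmem (by rw [Scheme.basicOpen_pow _ _ hd]; exact hv)
  obtain ⟨J, hJ, -, hJO, -⟩ := exists_isPrincipalCentre_of_agree_filtration_eq hG M O hO 𝒦₀ hd hprin hagree hBc hBcov hsupp
  refine killsIn_one_of_disjointPrincipalFamily_datum hp hG f M 𝔄 (fun _ : Unit => J) hd (fun _ => hJ) ?_ (fun _ : η => ()) O (fun i => hJO i) ?_ hF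
  · intro i j hij; exact absurd (Subsingleton.elim i j) hij
  · intro c j hj; exact absurd (Subsingleton.elim j ()) hj

end Summit.ResolutionOfSingularities.ResolutionOfSingularities.Theorems.WildQuotientResolution.S1.GameFrame.GModel

end
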